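import Summits.RiemannHypothesis.RiemannHypothesis.Theorems.MotivicDoor.AWS.Plumbing

/-!
# AWS plumbing I bis: the Hodge field IS negative semidefiniteness on `⟨e₁, e₂⟩^⊥ ⊂ L ⊗ ℝ` (both ways)

HONEST LABEL (verbatim on every AWS file).  One-way implication from a strengthened, prime-side-only
axiom system; the existence of such an object is NOT claimed and is the located gap; the converse
(RH ⇒ existence) is out of scope and, for this axiom system, tautological rather than informative
(HOME `AXIOM-CONTENT.md` §2; `AWS/Tautological`, `AWS/PrimeSideLattice`; REFEREE-1 B36/B39):
`Nonempty ArithmeticWeilSurface` is a restatement of RH in structure clothing, NOT evidence for RH.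
Framing: lottery ticket at the motivic door; RH probability negligible; consolation prizes are
real: a new semi-local Weil-positivity theorem, or a located gap in the Connes–Consani programme,
plus the ff-door theorem.  No `ζ`, no zeros, no `RiemannHypothesis` in this file.

AWS-DESIGN §5(d) states that the field `ArithmeticWeilSurface.hodge` — phrased on finite real
combinations of lattice vectors to keep `TensorProduct` out of the structure — is EQUIVALENT to the
Hodge-index sign condition on the base-changed form.  `AWS/Plumbing` proved the direction
field ⇒ `L ⊗ ℝ` for a surface `X`; this file records the equivalence for ABSTRACT data
`(L, B, e₁, e₂)` (generic `LatticePairing.baseChange`), so that constructors may verify the field in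
whichever language is convenient:

* `IsHodgeNonpos.baseChange_self_nonpos` — field shape ⇒ `B_ℝ(z,z) ≤ 0` for all
  `z ⊥ 1 ⊗ e₁, 1 ⊗ e₂` in `ℝ ⊗[ℤ] L`;
* `IsHodgeNonpos.of_baseChange` — the converse;
* `isHodgeNonpos_iff_baseChange` — the equivalence (PROVED).
-/

noncomputable section

open TensorProduct
open scoped BigOperators

namespace Summit.RiemannHypothesis.RiemannHypothesis.Theorems.MotivicDoor.AWS

namespace IsHodgeNonpos

variable {L : Type*} [AddCommGroup L] {B : L →+ L →+ ℝ} {e₁ e₂ : L}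

/-- **Field shape ⇒ `L ⊗ ℝ`**: if the pairing is nonpositive on finite real combinations of lattice
vectors orthogonal to `e₁, e₂`, then the base-changed form is nonpositive on
`⟨1 ⊗ e₁, 1 ⊗ e₂⟩^⊥ ⊂ ℝ ⊗[ℤ] L` (every tensor is a finite sum of pure tensors). -/
theorem baseChange_self_nonpos (H : IsHodgeNonpos B e₁ e₂) (z : ℝ ⊗[ℤ] L)
    (h₁ : LatticePairing.baseChange B z (LatticePairing.ofLattice e₁) = 0)
    (h₂ : LatticePairing.baseChange B z (LatticePairing.ofLattice e₂) = 0) :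
    LatticePairing.baseChange B z z ≤ 0 := by
  classical
  obtain ⟨S, rfl⟩ := TensorProduct.exists_finset z
  simp only [map_sum, LinearMap.sum_apply, LatticePairing.ofLattice_apply,
    LatticePairing.baseChange_tmul, mul_one] at h₁ h₂ ⊢
  simp only [← Finset.sum_coe_sort S] at h₁ h₂ ⊢
  rw [Finset.sum_comm]
  exact H.fintype (fun i : S ↦ (i : ℝ × L).2) (fun i : S ↦ (i : ℝ × L).1) h₁ h₂

/-- **`L ⊗ ℝ` ⇒ field shape**: negative semidefiniteness of the base-changed form on
`⟨1 ⊗ e₁, 1 ⊗ e₂⟩^⊥` gives the field `hodge` (take `z = Σ a_k ⊗ v_k`). -/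
theorem of_baseChange
    (H : ∀ z : ℝ ⊗[ℤ] L, LatticePairing.baseChange B z (LatticePairing.ofLattice e₁) = 0 →
      LatticePairing.baseChange B z (LatticePairing.ofLattice e₂) = 0 →
        LatticePairing.baseChange B z z ≤ 0) :
    IsHodgeNonpos B e₁ e₂ := by
  intro n v a h₁ h₂
  have h := H (∑ k, a k ⊗ₜ[ℤ] v k)
    (by simpa only [map_sum, LinearMap.sum_apply, LatticePairing.ofLattice_apply,
      LatticePairing.baseChange_tmul, mul_one] using h₁)
    (by simpa only [map_sum, LinearMap.sum_apply, LatticePairing.ofLattice_apply,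
      LatticePairing.baseChange_tmul, mul_one] using h₂)
  simp only [map_sum, LinearMap.sum_apply, LatticePairing.baseChange_tmul] at h
  rw [Finset.sum_comm] at h
  exact h

end IsHodgeNonpos

/-- **AWS-DESIGN §5(d), PROVED**: the Hodge field (finite real combinations of lattice vectors) is
EQUIVALENT to negative semidefiniteness of the base-changed form on `⟨1 ⊗ e₁, 1 ⊗ e₂⟩^⊥ ⊂ ℝ ⊗[ℤ] L`. -/
theorem isHodgeNonpos_iff_baseChange {L : Type*} [AddCommGroup L] (B : L →+ L →+ ℝ) (e₁ e₂ : L) :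
    IsHodgeNonpos B e₁ e₂ ↔
      ∀ z : ℝ ⊗[ℤ] L, LatticePairing.baseChange B z (LatticePairing.ofLattice e₁) = 0 →
        LatticePairing.baseChange B z (LatticePairing.ofLattice e₂) = 0 →
          LatticePairing.baseChange B z z ≤ 0 :=
  ⟨fun H z ↦ H.baseChange_self_nonpos z, IsHodgeNonpos.of_baseChange⟩

namespace ArithmeticWeilSurface

/-- For a surface `X`: the field `X.hodge` in the language of `X.Lℝ = ℝ ⊗[ℤ] X.L` and `X.interBC`,
as an `iff` with the abstract field shape (cf. `interBC_self_nonpos_of_perp`). -/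
theorem isHodgeNonpos_iff_interBC (X : ArithmeticWeilSurface) :
    IsHodgeNonpos X.inter X.e₁ X.e₂ ↔
      ∀ z : X.Lℝ, X.interBC z X.E₁ = 0 → X.interBC z X.E₂ = 0 → X.interBC z z ≤ 0 :=
  isHodgeNonpos_iff_baseChange X.inter X.e₁ X.e₂

end ArithmeticWeilSurface

end Summit.RiemannHypothesis.RiemannHypothesis.Theorems.MotivicDoor.AWS
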